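import Summits.Ventures.HodgeRepro.Night1AndreOrbits

/-!
# S3 (André 1992 / Milne 2020 Theorem 1) on the kernel, IV: the DIRECT-SUM form — the space of Hodge
classes of `A` is the independent sum, over the Galois orbits of Pohlmann `2p`-sets, of the pulled-back
Weil spaces `f_Δ^*(W_F(A_Δ))`, and `dim B^p(A) ⊗ ℂ` is the sum of the orbit lengths

Blind re-derivation cell `pub-hodge-repro`, seat `night-1` (gen 6).  Imports night-1's
`Night1AndreOrbits` (the canonical wedges `sizedWedge`, their linear independence, the orbit `orbitSets Δ`,
`map_andrePull_weilSpaceProd_eq_span_orbit`, `finrank_map_andrePull_weilSpaceProd`,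
`finrank_jointEigenspaceOn`).  Namespace `HodgeRepro.RouteC`.

Milne 2020 (store `paper:arxiv-2010.08857`) p0005:L74–76: «this implies that the subspaces
`f_Δ^*(W_F(A_Δ))` span `B^p`».  On the kernel the span is DIRECT once the `Δ` are taken one per Galois
orbit — `Δ` and `g • Δ` give the same subspace (`map_andrePull_weilSpaceProd_smul`), different orbits
meet trivially (`disjoint_map_andrePull_weilSpaceProd`) — and the dimensions add up:

* `iSupIndep_span_image_of_pairwise_disjoint` — the general fact: spans of pairwise disjoint
  subfamilies of a linearly independent family are `iSupIndep`;
* `pohlmannOrbits c Φ p` — the Galois orbits of the Pohlmann `2p`-sets, a finset of finsets;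
  `orbitSpan O n` — the span of the canonical wedges of the members of `O`;
  `orbitSpan_orbitSets` — for `O = G • Δ` it is `f_Δ^*(W_F(A_Δ)) ⊗ ℂ`;
* **`jointEigenspaceOn_eq_iSup_orbitSpan`** — `B^p(A) ⊗ ℂ = ⨆_{O ∈ pohlmannOrbits} orbitSpan O`;
* **`iSupIndep_orbitSpan`** — the summands are independent (the sum is direct);
* `finrank_orbitSpan_of_mem` — `dim orbitSpan O = |O|`; `hodgeCountOn_eq_sum_card_pohlmannOrbits` —
  Pohlmann's count is the sum of the orbit lengths; **`finrank_jointEigenspaceOn_eq_sum`** —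
  `dim B^p(A) ⊗ ℂ = Σ_O dim f_Δ^*(W_F(A_Δ)) ⊗ ℂ`.

Nothing geometric is built; every statement is about coordinate wedges on finite `G`-sets.  Nothing here
says anything about the status of the Hodge conjecture for CM abelian varieties, which is NOT proved.
-/

set_option autoImplicit false

open Finset Module
open scoped Pointwise

namespace HodgeRepro.RouteC

open CMHodgeOn

/-! ### Spans of disjoint subfamilies of an independent family are independent -/

section General

variable {ι ι' R M : Type*} [Ring R] [AddCommGroup M] [Module R M]

/-- **Spans of pairwise disjoint subfamilies of a linearly independent family form an independent family
of submodules** (`iSupIndep`): each one meets the sum of the others in `0`. -/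
theorem iSupIndep_span_image_of_pairwise_disjoint {v : ι → M} (hv : LinearIndependent R v)
    (s : ι' → Set ι) (hs : Pairwise fun i j => Disjoint (s i) (s j)) :
    iSupIndep fun i => Submodule.span R (v '' s i) := by
  rw [iSupIndep_def]
  intro i
  have h : (⨆ (j) (_ : j ≠ i), Submodule.span R (v '' s j)) =
      Submodule.span R (v '' ⋃ (j) (_ : j ≠ i), s j) := by
    rw [Set.image_iUnion₂, Submodule.span_iUnion₂]
  rw [h]
  refine hv.disjoint_span_image ?_
  rw [Set.disjoint_iUnion₂_right]
  intro j hj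
  exact hs (Ne.symm hj)

end General

/-! ### The Galois orbits of the Pohlmann sets and their subspaces -/

section Orbits

variable {G : Type*} [Group G] [DecidableEq G] [Fintype G] {X : Type*} [MulAction G X] [Fintype X]
  [DecidableEq X]

/-- The Galois orbits of the Pohlmann `2p`-subsets of `(X, Φ)`: a finset of finsets of subsets. -/
def pohlmannOrbits (c : G) (Φ : Finset X) (p : ℕ) : Finset (Finset (Finset X)) :=
  (univ.filter fun Δ : Finset X => Δ.card = 2 * p ∧ IsHodgeSetOn c Φ Δ).image (orbitSets (G := G))

omit [DecidableEq G] in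
/-- Membership in the set of Pohlmann orbits. -/
theorem mem_pohlmannOrbits {c : G} {Φ : Finset X} {p : ℕ} {O : Finset (Finset X)} :
    O ∈ pohlmannOrbits c Φ p ↔
      ∃ Δ : Finset X, (Δ.card = 2 * p ∧ IsHodgeSetOn c Φ Δ) ∧ orbitSets (G := G) Δ = O := by
  simp [pohlmannOrbits]

omit [DecidableEq G] [Fintype X] in
/-- The orbit of a member of the orbit of `Δ` is the orbit of `Δ`. -/
theorem orbitSets_eq_of_mem {Δ Δ' : Finset X} (h : Δ' ∈ orbitSets (G := G) Δ) :
    orbitSets (G := G) Δ' = orbitSets (G := G) Δ := by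
  obtain ⟨g, rfl⟩ := mem_orbitSets.1 h
  exact orbitSets_smul g Δ

omit [DecidableEq G] in
/-- Every member of a Pohlmann orbit is a Pohlmann `2p`-set. -/
theorem pohlmann_of_mem_of_mem_pohlmannOrbits {c : G} {Φ : Finset X} {p : ℕ} {O : Finset (Finset X)}
    (hO : O ∈ pohlmannOrbits c Φ p) {S : Finset X} (hS : S ∈ O) :
    S.card = 2 * p ∧ IsHodgeSetOn c Φ S := by
  obtain ⟨Δ, ⟨hcard, hΔ⟩, rfl⟩ := mem_pohlmannOrbits.1 hO
  obtain ⟨σ, rfl⟩ := mem_orbitSets.1 hS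
  exact ⟨by rw [card_smul_finset, hcard], hΔ.smul σ⟩

omit [DecidableEq G] in
/-- Two Pohlmann orbits are disjoint or equal. -/
theorem pohlmannOrbits_pairwiseDisjoint (c : G) (Φ : Finset X) (p : ℕ) :
    ((pohlmannOrbits c Φ p : Finset (Finset (Finset X))) : Set (Finset (Finset X))).PairwiseDisjoint
      (id : Finset (Finset X) → Finset (Finset X)) := by
  intro O hO O' hO' hne
  rw [Finset.mem_coe, mem_pohlmannOrbits] at hO hO'
  obtain ⟨Δ, -, rfl⟩ := hO
  obtain ⟨Δ', -, rfl⟩ := hO'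
  rw [Function.onFun, id, id, Finset.disjoint_left]
  intro S hS hS'
  exact hne (orbitSets_eq_of_mem (mem_orbitSets_of_mem_of_mem hS hS')).symm

omit [DecidableEq G] in
/-- The Pohlmann `2p`-sets are the union of the Pohlmann orbits. -/
theorem filter_pohlmann_eq_biUnion_pohlmannOrbits (c : G) (Φ : Finset X) (p : ℕ) :
    (univ.filter fun Δ : Finset X => Δ.card = 2 * p ∧ IsHodgeSetOn c Φ Δ) =
      (pohlmannOrbits c Φ p).biUnion id := by
  ext S
  simp only [mem_filter, mem_univ, true_and, mem_biUnion, id]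
  constructor
  · intro h
    exact ⟨orbitSets (G := G) S, mem_pohlmannOrbits.2 ⟨S, h, rfl⟩, mem_orbitSets_self S⟩
  · rintro ⟨O, hO, hS⟩
    exact pohlmann_of_mem_of_mem_pohlmannOrbits hO hS

omit [DecidableEq G] in
/-- **Pohlmann's count is the sum of the orbit lengths**: `hodgeCountOn c Φ p = Σ_{O} |O|` over the Galois
orbits of Pohlmann `2p`-sets. -/
theorem hodgeCountOn_eq_sum_card_pohlmannOrbits (c : G) (Φ : Finset X) (p : ℕ) :
    hodgeCountOn c Φ p = ∑ O ∈ pohlmannOrbits c Φ p, O.card := by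
  unfold hodgeCountOn
  rw [filter_pohlmann_eq_biUnion_pohlmannOrbits, card_biUnion (pohlmannOrbits_pairwiseDisjoint c Φ p)]
  rfl

/-- The subspace of an orbit `O` of `n`-sets: the span of the canonical wedges of its members. -/
noncomputable def orbitSpan (O : Finset (Finset X)) (n : ℕ) : Submodule ℂ (⋀[ℂ]^n (X → ℂ)) :=
  Submodule.span ℂ (sizedWedge '' {S : SizedSets X n | S.1 ∈ O})

omit [Fintype X] in
/-- **The subspace of the orbit of `Δ` is the pulled-back Weil space `f_Δ^*(W_F(A_Δ)) ⊗ ℂ`.** -/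
theorem orbitSpan_orbitSets {p : ℕ} (Δ : Finset X) (e : Fin (2 * p) ≃ ↥Δ) :
    orbitSpan (orbitSets (G := G) Δ) (2 * p) = (weilSpaceProd G p e).map (andrePull Δ (2 * p)) :=
  (map_andrePull_weilSpaceProd_eq_span_orbit Δ e).symm

/-- `dim orbitSpan O = |O|` for a Pohlmann orbit `O` (the orbit length, `finrank_map_andrePull_weilSpaceProd`). -/
theorem finrank_orbitSpan_of_mem {c : G} {Φ : Finset X} {p : ℕ} {O : Finset (Finset X)}
    (hO : O ∈ pohlmannOrbits c Φ p) : finrank ℂ (orbitSpan O (2 * p)) = O.card := by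
  obtain ⟨Δ, ⟨hcard, -⟩, rfl⟩ := mem_pohlmannOrbits.1 hO
  rw [orbitSpan_orbitSets Δ (Finset.equivFinOfCardEq hcard).symm,
    finrank_map_andrePull_weilSpaceProd Δ _ hcard]

omit [DecidableEq G] in
/-- The set of Pohlmann `2p`-sets (as sized sets) is the union of the Pohlmann orbits. -/
theorem setOf_pohlmann_eq_iUnion (c : G) (Φ : Finset X) (p : ℕ) :
    {S : SizedSets X (2 * p) | IsHodgeSetOn c Φ S.1} =
      ⋃ (O) (_ : O ∈ pohlmannOrbits c Φ p), {S : SizedSets X (2 * p) | S.1 ∈ O} := by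
  ext S
  simp only [Set.mem_setOf_eq, Set.mem_iUnion, exists_prop]
  constructor
  · intro h
    exact ⟨orbitSets (G := G) S.1, mem_pohlmannOrbits.2 ⟨S.1, ⟨S.2, h⟩, rfl⟩, mem_orbitSets_self S.1⟩
  · rintro ⟨O, hO, hS⟩
    exact (pohlmann_of_mem_of_mem_pohlmannOrbits hO hS).2

omit [DecidableEq G] in
/-- **Theorem 1 as a sum over orbits**: the space of Hodge classes of `A` in degree `2p` is the sum, over
the Galois orbits `O` of Pohlmann `2p`-sets, of the subspaces `orbitSpan O = f_Δ^*(W_F(A_Δ)) ⊗ ℂ`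
(`Δ ∈ O`). -/
theorem jointEigenspaceOn_eq_iSup_orbitSpan {c : G} (hc : IsComplexConj c) {Φ : Finset X}
    (hΦ : IsCMTypeOn c Φ) (p : ℕ) :
    jointEigenspaceOn (fun g : G => g • Φ) (2 * p) p =
      ⨆ (O) (_ : O ∈ pohlmannOrbits c Φ p), orbitSpan O (2 * p) := by
  rw [← span_range_pohlmannWedge hc hΦ p]
  have h : Set.range (pohlmannWedge c Φ p) = sizedWedge '' {S : SizedSets X (2 * p) | IsHodgeSetOn c Φ S.1} := by
    rw [show pohlmannWedge c Φ p = sizedWedge ∘ Subtype.val from rfl, Set.range_comp,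
      Subtype.range_coe_subtype]
  rw [h, setOf_pohlmann_eq_iUnion, Set.image_iUnion₂, Submodule.span_iUnion₂]
  rfl

omit [DecidableEq G] in
/-- **The sum is direct**: the subspaces of distinct Pohlmann orbits are independent (`iSupIndep`). -/
theorem iSupIndep_orbitSpan (c : G) (Φ : Finset X) (p : ℕ) :
    iSupIndep fun O : ↥(pohlmannOrbits c Φ p) => orbitSpan O.1 (2 * p) := by
  refine iSupIndep_span_image_of_pairwise_disjoint (linearIndependent_sizedWedge (2 * p))
    (fun O : ↥(pohlmannOrbits c Φ p) => {S : SizedSets X (2 * p) | S.1 ∈ O.1}) ?_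
  intro O O' hne
  have hd : Disjoint O.1 O'.1 :=
    pohlmannOrbits_pairwiseDisjoint c Φ p O.2 O'.2 (fun h => hne (Subtype.ext h))
  rw [Set.disjoint_left]
  intro S hS hS'
  exact Finset.disjoint_left.1 hd hS hS'

/-- **`dim B^p(A) ⊗ ℂ = Σ_O dim f_Δ^*(W_F(A_Δ)) ⊗ ℂ`** over the Galois orbits of Pohlmann `2p`-sets: the
dimension of the space of Hodge classes is the sum of the dimensions of the pulled-back Weil spaces, one
per orbit. -/
theorem finrank_jointEigenspaceOn_eq_sum {c : G} (hc : IsComplexConj c) {Φ : Finset X}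
    (hΦ : IsCMTypeOn c Φ) (p : ℕ) :
    finrank ℂ (jointEigenspaceOn (fun g : G => g • Φ) (2 * p) p) =
      ∑ O ∈ pohlmannOrbits c Φ p, finrank ℂ (orbitSpan O (2 * p)) := by
  rw [finrank_jointEigenspaceOn hc hΦ p, hodgeCountOn_eq_sum_card_pohlmannOrbits]
  exact Finset.sum_congr rfl fun O hO => (finrank_orbitSpan_of_mem hO).symm

end Orbits

end HodgeRepro.RouteC
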